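import Literature.Analysis.FunctionSpaces.PoissonCountFKG
import HarnessLib

/-!
# The Harris–FKG inequality for Poisson point processes (named fact)

(topic Analysis/FunctionSpaces; one named fact, no new objects.)

A configuration `c : PointConfig E` is a locally finite SET of points and the count σ-algebra is the
tree's `PointConfig.instMeasurableSpace`; configurations are ordered by inclusion (the `SetLike`
partial order), so an event `A ⊆ PointConfig E` is INCREASING iff it is an upper set
(`IsUpperSet A`: `c ∈ A`, `c ⊆ c'` ⇒ `c' ∈ A` — "adding points preserves `A`").  The
**Harris–FKG inequality for Poisson processes** (Last–Penrose 2017, Thm. 20.4; Roy 1991, by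
reduction to Harris' lemma for Bernoulli fields; Janson 1984 for finite intensity) says that under a
Poisson point process increasing events are positively correlated.  In the tree's vocabulary:
the law `P` of a Poisson point process is POSITIVELY ASSOCIATED
(`Literature.Probability.Percolation.IsPositivelyAssociated P`:
`P A · P B ≤ P (A ∩ B)` for measurable upper sets `A`, `B`).

Its finite-partition layer — positive association of the COUNT VECTOR over finitely many
disjoint sets — is PROVED in `PoissonCountFKG.lean`
(`IsPoissonPointProcess.isPositivelyAssociated_map_counts`); the full statement is the limit of
that layer along partitions generating the count σ-algebra (Lévy's upward theorem applied to
`P[𝟙_A | counts of the partition]`, an increasing function of the count vector) and is vendored here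
as a named fact, the hypothesis of Benjamini–Schramm's "lemmas of clean configurations"
(Comm. Math. Phys. 197 (1998), §7) and of every RSW argument for Poisson–Voronoi percolation
(Bollobás–Riordan 2006, Ch. 8, Lemma 14; Tassion 2016).

## References

* G. Last, M. Penrose, *Lectures on the Poisson Process*, Cambridge University Press (2017),
  §20.3, Thm. 20.4, p. 217. [cite: LastPenrose2017, Thm 20.4]
* R. Roy, The Russo–Seymour–Welsh theorem and the equality of critical densities and the "dual"
  critical densities for continuum percolation on `ℝ²`, *Ann. Probab.* 18 (1990) 1563–1575, Lemma 2.3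
  (FKG for Poisson Boolean models).
* B. Bollobás, O. Riordan, *Percolation*, Cambridge University Press (2006), Ch. 8, Lemma 14.
-/

namespace Literature.Analysis.FunctionSpaces

open _root_.MeasureTheory

variable {E : Type*} [TopologicalSpace E]

/-- Configurations are ordered by INCLUSION of their point sets (the `SetLike` order): `c ≤ c'`
iff every point of `c` is a point of `c'`.  Increasing events / functionals of a point process
(Last–Penrose 2017, §20.3: "`f(μ + δ_x) ≥ f(μ)`") are the monotone ones for this order. [cite: LastPenrose2017, §20.3] -/
instance PointConfig.instPartialOrder : PartialOrder (PointConfig E) :=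
  PartialOrder.lift _ SetLike.coe_injective

/-- Unfolding of the inclusion order on configurations. [folklore] -/
theorem PointConfig.le_iff_coe_subset {c c' : PointConfig E} : c ≤ c' ↔ (c : Set E) ⊆ (c' : Set E) :=
  Iff.rfl

/-- Adding points goes up in the inclusion order: `c ≤ c ∪ d`. [folklore] -/
theorem PointConfig.le_union_left (c d : PointConfig E) : c ≤ c ∪ d :=
  fun _ hx => Set.mem_union_left _ hx

/-- **Harris–FKG inequality for Poisson point processes** (Last–Penrose 2017, Thm. 20.4): on a
second-countable locally compact Hausdorff Borel space (where configurations — finite on compact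
sets — have finite counts on a countable generating π-system of relatively compact sets,
`PointConfig.measurableSpace_eq_iSup_comap_count_of_generateFrom`), the law `P` of a Poisson point
process with locally finite (hence σ-finite) intensity `ν` is positively associated for the inclusion order on configurations — for measurable
increasing events `A, B ⊆ PointConfig E` (upper sets: stable under adding points),
`P A * P B ≤ P (A ∩ B)`.  Equivalent covariance form: `E[f g] ≥ E[f] E[g]` for increasing
`f, g ∈ L²(P)`.  The finite-partition layer is the PROVED
`IsPoissonPointProcess.isPositivelyAssociated_map_counts`.
-- TODO(general form): Last–Penrose state it for increasing `L²` functionals of a (proper) Poisson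
-- process on an arbitrary σ-finite measure space.
[cite: LastPenrose2017, Thm 20.4] -/
def IsPoissonPointProcess.harrisFKG : Prop :=
  ∀ {E : Type*} [TopologicalSpace E] [T2Space E] [SecondCountableTopology E] [LocallyCompactSpace E]
    [MeasurableSpace E] [BorelSpace E] {ν : Measure E} [IsLocallyFiniteMeasure ν]
    {P : Measure (PointConfig E)},
    IsPoissonPointProcess ν P → Literature.Probability.Percolation.IsPositivelyAssociated P

end Literature.Analysis.FunctionSpaces
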